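import Mathlib
import Summits.Ventures.PercRepro.TriangleCapStarFamilyDefs

/-!
# PercRepro — THE STAR FAMILY WITH TWO SHORT CENTRE ROWS: THE INDEX FUNCTIONS AND THEIR PHASES (p3, gen 57; part 339)

The star family of part 315 with its FIRST TWO centre rows short: `a` special non-neighbours `1, …, a` joined by
inside edges to one centre `a + Q + 1`, `Q` regular non-neighbours `a + 1, …, a + Q`; the rows (leaves of `w`) are
`Rc ≥ 2` CENTRE ROWS `ℓ + 1, …, ℓ + Rc` (each = the centre plus `D − 1` regular columns; the first one SHORT by `sh0`,
the second by `sh1`), `D − 1` OUTER ROWS `ℓ + Rc + 1, …, ℓ + Rc + D − 1` (each = every special plus `D − a` regular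
columns) and `E` EXTRA ROWS (each = `D` regular columns).  The regular columns are swept cyclically
(`a + 1 + (p mod Q)`) through the regular slots of the rows in order — the rows are the blocks of the cyclic block
witness of part 288 (`rfMulti`, block sizes `kSF2`): the left ends are `lfSF` of part 315, the right ends `rfSF2` on
`Rc + a (D − 1) + Q D` indices, in three phases (centre pairs, special pairs, regular pairs).  The witnesses of
parts 341–343 take `(sh0, sh1) = (D − 1, 2 ρ + 1)` and `(D − 1, D − 1)`.  Axioms: standard.
-/
namespace PercRepro

namespace TriangleCap

namespace C047

open Finset

/-- The regular-slot sizes of the rows: the short centre rows `0` and `1` carry `D − 1 − sh0` and `D − 1 − sh1`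
regular columns, the other centre rows `D − 1`, the `D − 1` outer rows `D − a`, the extra rows `D`. -/
def kSF2 (D a Rc sh0 sh1 ρ : ℕ) : ℕ :=
  if ρ = 0 then D - 1 - sh0 else if ρ = 1 then D - 1 - sh1 else if ρ < Rc then D - 1
  else if ρ < Rc + (D - 1) then D - a else D

/-- The right ends: the centre row `ℓ + 1 + i`, the outer row `ℓ + 1 + Rc + ⌊(i − Rc) / a⌋`, the block row of the
regular position. -/
def rfSF2 (ℓ D a Rc sh0 sh1 E i : ℕ) : ℕ :=
  if i < Rc then ℓ + 1 + i
  else if i < Rc + a * (D - 1) then ℓ + 1 + Rc + (i - Rc) / a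
  else rfMulti ℓ (kSF2 D a Rc sh0 sh1) (Rc + (D - 1) + E) (i - Rc - a * (D - 1))

/-- The centre rows. -/
theorem rfSF2_phaseC (ℓ D a Rc sh0 sh1 E i : ℕ) (hi : i < Rc) : rfSF2 ℓ D a Rc sh0 sh1 E i = ℓ + 1 + i := by
  unfold rfSF2
  rw [if_pos hi]

/-- The outer rows. -/
theorem rfSF2_phaseS (ℓ D a Rc sh0 sh1 E i : ℕ) (hi : i < a * (D - 1)) :
    rfSF2 ℓ D a Rc sh0 sh1 E (Rc + i) = ℓ + 1 + Rc + i / a := by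
  unfold rfSF2
  rw [if_neg (by omega), if_pos (by omega), Nat.add_sub_cancel_left]

/-- The block rows. -/
theorem rfSF2_phaseR (ℓ D a Rc sh0 sh1 E i : ℕ) :
    rfSF2 ℓ D a Rc sh0 sh1 E (Rc + a * (D - 1) + i) = rfMulti ℓ (kSF2 D a Rc sh0 sh1) (Rc + (D - 1) + E) i := by
  unfold rfSF2
  rw [if_neg (by omega), if_neg (by omega)]
  have : Rc + a * (D - 1) + i - Rc - a * (D - 1) = i := by omega
  rw [this]

/-- **THE BLOCK SUM:** the regular slots of all rows number `Q D` under the incidence identity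
`Rc (D − 1) + (D − 1)(D − a) + E D = Q D + sh0 + sh1`. -/
theorem blockSum_kSF2 (D a Rc sh0 sh1 E Q : ℕ) (hRc : 2 ≤ Rc) (hsh0 : sh0 + 1 ≤ D) (hsh1 : sh1 + 1 ≤ D)
    (hinc : Rc * (D - 1) + (D - 1) * (D - a) + E * D = Q * D + (sh0 + sh1)) :
    blockSum (kSF2 D a Rc sh0 sh1) (Rc + (D - 1) + E) = Q * D := by
  unfold blockSum
  rw [range_eq_Ico, ← sum_Ico_consecutive _ (Nat.zero_le 1) (by omega : 1 ≤ Rc + (D - 1) + E),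
    ← sum_Ico_consecutive _ (by omega : 1 ≤ 2) (by omega : 2 ≤ Rc + (D - 1) + E),
    ← sum_Ico_consecutive _ (by omega : 2 ≤ Rc) (by omega : Rc ≤ Rc + (D - 1) + E),
    ← sum_Ico_consecutive _ (by omega : Rc ≤ Rc + (D - 1)) (by omega : Rc + (D - 1) ≤ Rc + (D - 1) + E)]
  rw [sum_const_nat (m := D - 1 - sh0) (fun x hx => by
      rw [mem_Ico] at hx
      unfold kSF2
      rw [if_pos (by omega)]),
    sum_const_nat (m := D - 1 - sh1) (fun x hx => by
      rw [mem_Ico] at hx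
      unfold kSF2
      rw [if_neg (by omega), if_pos (by omega)]),
    sum_const_nat (m := D - 1) (fun x hx => by
      rw [mem_Ico] at hx
      unfold kSF2
      rw [if_neg (by omega), if_neg (by omega), if_pos (by omega)]),
    sum_const_nat (m := D - a) (fun x hx => by
      rw [mem_Ico] at hx
      unfold kSF2
      rw [if_neg (by omega), if_neg (by omega), if_neg (by omega), if_pos (by omega)]),
    sum_const_nat (m := D) (fun x hx => by
      rw [mem_Ico] at hx
      unfold kSF2
      rw [if_neg (by omega), if_neg (by omega), if_neg (by omega), if_neg (by omega)])]
  simp only [Nat.card_Ico]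
  obtain ⟨R, rfl⟩ : ∃ R, Rc = R + 2 := ⟨Rc - 2, by omega⟩
  have e1 : R + 2 - 2 = R := by omega
  have e2 : R + 2 + (D - 1) - (R + 2) = D - 1 := by omega
  have e3 : R + 2 + (D - 1) + E - (R + 2 + (D - 1)) = E := by omega
  rw [e1, e2, e3, Nat.sub_zero, one_mul, one_mul]
  have e4 : (R + 2) * (D - 1) = R * (D - 1) + (D - 1) + (D - 1) := by ring
  rw [e4] at hinc
  omega

/-- The block sizes are at most `Q`: `D − 1 ≤ Q`, and `D ≤ Q` when there are extra rows. -/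
theorem kSF2_le (D a Rc sh0 sh1 E Q ρ : ℕ) (ha : 1 ≤ a) (hQ1 : D ≤ Q + 1) (hQE : 1 ≤ E → D ≤ Q)
    (hρ : ρ < Rc + (D - 1) + E) : kSF2 D a Rc sh0 sh1 ρ ≤ Q := by
  unfold kSF2
  split_ifs with h1 h2 h3 h4
  · omega
  · omega
  · omega
  · omega
  · exact hQE (by omega)

/-- The bounds of the right ends: `ℓ + 1 ≤ rfSF2 i < ℓ + 1 + (Rc + (D − 1) + E)` on the index range. -/
theorem rfSF2_bounds (ℓ D a Rc sh0 sh1 E Q i : ℕ) (ha : 1 ≤ a) (hRc : 2 ≤ Rc) (hsh0 : sh0 + 1 ≤ D)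
    (hsh1 : sh1 + 1 ≤ D)
    (hinc : Rc * (D - 1) + (D - 1) * (D - a) + E * D = Q * D + (sh0 + sh1)) (hi : i < Rc + a * (D - 1) + Q * D) :
    ℓ + 1 ≤ rfSF2 ℓ D a Rc sh0 sh1 E i ∧ rfSF2 ℓ D a Rc sh0 sh1 E i < ℓ + 1 + (Rc + (D - 1) + E) := by
  unfold rfSF2
  split_ifs with h1 h2
  · omega
  · have hdiv : (i - Rc) / a < D - 1 := by
      rw [Nat.div_lt_iff_lt_mul (by omega)]
      have := Nat.mul_comm a (D - 1)
      omega
    have h0 := Nat.zero_le ((i - Rc) / a)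
    refine ⟨by omega, ?_⟩
    calc ℓ + 1 + Rc + (i - Rc) / a < ℓ + 1 + Rc + (D - 1) := Nat.add_lt_add_left hdiv _
      _ ≤ ℓ + 1 + (Rc + (D - 1) + E) := by omega
  · have hb := rfMulti_bounds ℓ (kSF2 D a Rc sh0 sh1) (Rc + (D - 1) + E) (i - Rc - a * (D - 1)) (by
      rw [blockSum_kSF2 D a Rc sh0 sh1 E Q hRc hsh0 hsh1 hinc]
      omega)
    exact hb

/-- The centre pairs lie on the centre rows. -/
theorem rfSF2_of_centre (ℓ D a Rc sh0 sh1 E i : ℕ) (hi : i < Rc) :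
    rfSF2 ℓ D a Rc sh0 sh1 E i < ℓ + 1 + Rc := by
  rw [rfSF2_phaseC ℓ D a Rc sh0 sh1 E i hi]
  omega

/-- The special pairs lie on the outer rows. -/
theorem rfSF2_of_special (ℓ D a Rc sh0 sh1 E i : ℕ) (hi1 : Rc ≤ i) (hi2 : i < Rc + a * (D - 1)) :
    ℓ + 1 + Rc ≤ rfSF2 ℓ D a Rc sh0 sh1 E i := by
  obtain ⟨i', rfl⟩ : ∃ i', i = Rc + i' := ⟨i - Rc, by omega⟩
  rw [rfSF2_phaseS ℓ D a Rc sh0 sh1 E i' (by omega)]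
  exact Nat.le_add_right _ _

end C047

end TriangleCap

end PercRepro
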